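import Literature.Geometry.Lorentzian.KerrRedShiftEstimate

/-!
# Route ClusterCompleteness — crux `AdiabaticMultiKerrILED`, line `Sketch`:
# the weighted `T`-energy inequality between tilted leaves of the rest-frame tails-cut zone

Helper file for the crux `stmt-FinalStateConjecture-14310`
(`Summit.FinalStateConjecture.FinalStateConjecture.Theses.ClusterCompleteness.AdiabaticMultiKerrILED`),
line `Sketch`, stub `weightedTEnergy_graph_le` (lead c7, wave 2).

Setting (one zone, zero spin, rest frame): the coefficient field is the tails-cut Kerr–Schild field
`G₀ = KerrSchild.inverseMetric φ (Kerr.nullVector 0)` with profile `φ = χ(2 − r/(8M)) · 2H`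
(`χ = Real.smoothTransition`), the current is the Killing energy current
`(J^T)^μ = KerrSchild.multiplierCurrent G₀ KerrSchild.timeField Φ`, and the weight is
`W = χ(u₂/ε − 1) · χ(u₁)` with the receding horizon function `u₂ = Kerr.horizonFn M 0` and the cone
function `u₁ = Kerr.coneFn A c`. The lab slices are the tilted leaves `{x⁰ = t + F(x⃗)}` of a `C²`
height `F` of slope `≤ 1/2`, with conormal `n = Kerr.graphConormal F = (1, −∇F)`.

* `weightedGraphFlux_integral_le` — the abstract step: for a weight `W` vanishing off a closed set
  `K` whose points in the slab `{F(x⃗) ≤ x⁰ ≤ s + F(x⃗)}` are spatially bounded and satisfy a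
  property `P`, and a current `J` with `W J^μ ∈ C¹(ℝ⁴)` and `∑_μ ∂_μ(W J^μ) ≥ 0` at the slab points
  with `P`, the weighted flux `∫ W · (−∑ J^μ n_μ)` through the leaf `{x⁰ = s + F}` is at most the
  one through `{x⁰ = F}` (`E4.graphFlux_add_integral_le_of_divergence_le` for the current `−W J`
  with `ℓ = e = 0`, and the passage from ball integrals to integrals over `ℝ³`);
* `spatialNorm_le_of_coneFn_nonneg_of_slab` — the geometry of the slab points of the solid cone
  `{u₁ ≥ 0}`: from `‖x⃗ − c‖ ≤ |A − x⁰|`, `F(x⃗) ≤ x⁰ ≤ s + F(x⃗)`, the mean value inequality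
  `|F(x⃗) − F(c)| ≤ ‖x⃗ − c‖/2` and `s + F(c) < A` one gets `x⁰ < A` and
  `‖x⃗‖ ≤ ‖c‖ + 2(A − F(c))`;
* `weightedTEnergy_graph_le` — **the registered stub**: the support set `K = {ε ≤ u₂} ∩ {0 ≤ u₁}`
  is closed, `W = 0` off `K`, `r > 2M` on `K` (`u₂ ≥ ε > 0`), and the two items above.

Dafermos–Rodnianski–Shlapentokh-Rothman arXiv:1402.7034, §2.3.2 (the `T`-energy identity between
leaves, (ingeneralform2)); Hawking–Ellis 1973, §4.3 Lemma 4.3.1 (the region bounded by a backward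
cone and a receding hypersurface). [folklore]
-/

noncomputable section

-- the doubled `FinalStateConjecture.FinalStateConjecture` path component trips dupNamespace
set_option linter.dupNamespace false

open Set Filter Metric MeasureTheory
open scoped BigOperators Topology
open Literature.Geometry.Lorentzian

namespace Summit.FinalStateConjecture.FinalStateConjecture.Theorems

/-! ### The abstract weighted graph energy inequality -/

/-- **Weighted graph energy inequality, abstract form.** Let `K ⊆ ℝ⁴` be closed, `W` a weight
vanishing off `K`, `J` a current with `W J^μ ∈ C¹(ℝ⁴)`, `F` a `C²` height and `s ≥ 0`. Assume the
points of `K` in the slab `{F(x⃗) ≤ x⁰ ≤ s + F(x⃗)}` have `‖x⃗‖ ≤ ρ` and a property `P`, and that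
`∑_μ ∂_μ (W J^μ) ≥ 0` at the slab points with `P`. Then `∫ W (−∑_μ J^μ n_μ)` over the leaf
`{x⁰ = s + F}` is at most the same integral over `{x⁰ = F}` (`n = dt − dF`): the energy inequality
`E4.graphFlux_add_integral_le_of_divergence_le` for the current `−W J` with `ℓ = e = 0`, the
integrands vanishing for `‖y‖ > ρ`. [cite: DafermosRodnianskiShlapentokhrothman2014, §2.3.2] -/
theorem weightedGraphFlux_integral_le {K : Set E4} (hKc : IsClosed K) {W : E4 → ℝ}
    {J : Fin 4 → E4 → ℝ} (hJ1 : ∀ μ, ContDiff ℝ 1 fun y ↦ W y * J μ y)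
    (hWK : ∀ x, x ∉ K → W x = 0) {F : E3 → ℝ} (hF : ContDiff ℝ 2 F) {s ρ : ℝ} {P : E4 → Prop}
    (hρ : ∀ x ∈ K, F (E4.spatial x) ≤ x 0 → x 0 ≤ s + F (E4.spatial x) →
      E4.spatialNorm x ≤ ρ ∧ P x)
    (hdiv : ∀ x, F (E4.spatial x) ≤ x 0 → x 0 ≤ s + F (E4.spatial x) → P x →
      0 ≤ ∑ μ, fderiv ℝ (fun y ↦ W y * J μ y) x (E4.basisVector μ))
    (hs0 : 0 ≤ s) :
    ∫ y : E3, W (E4.ofTimeSpace (s + F y) y) *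
        (-∑ μ, J μ (E4.ofTimeSpace (s + F y) y) * Kerr.graphConormal F y μ) ≤
      ∫ y : E3, W (E4.ofTimeSpace (0 + F y) y) *
        (-∑ μ, J μ (E4.ofTimeSpace (0 + F y) y) * Kerr.graphConormal F y μ) := by
  -- the negated weighted current `J' = −W J`
  set J' : Fin 4 → E4 → ℝ := fun μ y ↦ -(W y * J μ y) with hJ'
  have hJ'1 : ∀ μ, ContDiff ℝ 1 (J' μ) := fun μ ↦ (hJ1 μ).neg
  have hJ'K : ∀ μ x, x ∉ K → J' μ x = 0 := fun μ x hx ↦ by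
    simp only [hJ', hWK x hx, zero_mul, neg_zero]
  have hρ' : ∀ x ∈ K, F (E4.spatial x) ≤ x 0 → x 0 ≤ s + F (E4.spatial x) →
      E4.spatialNorm x ≤ ρ := fun x hx h1 h2 ↦ (hρ x hx h1 h2).1
  have hdiv' : ∀ x ∈ K, F (E4.spatial x) ≤ x 0 → x 0 ≤ s + F (E4.spatial x) →
      ∑ μ, fderiv ℝ (J' μ) x (E4.basisVector μ) ≤
        -(fun _ : E4 ↦ (0 : ℝ)) x + (fun _ : E4 ↦ (0 : ℝ)) x := by
    intro x hx h1 h2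
    have h := hdiv x h1 h2 (hρ x hx h1 h2).2
    have he : ∀ μ, fderiv ℝ (J' μ) x = -fderiv ℝ (fun y ↦ W y * J μ y) x := fun μ ↦ by
      simp only [hJ', fderiv_fun_neg]
    simp only [he, neg_apply, Finset.sum_neg_distrib, neg_zero, zero_add]
    exact neg_nonpos.mpr h
  have key := E4.graphFlux_add_integral_le_of_divergence_le hKc hJ'1 hJ'K hF hρ'
    (ℓ := fun _ ↦ 0) (e := fun _ ↦ 0) continuous_const continuous_const (fun _ _ ↦ rfl)
    (fun _ ↦ le_rfl) hdiv' hs0 le_rfl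
  simp only [integral_zero, add_zero] at key
  -- from ball integrals of `∑ J'^μ n_μ` to integrals of `W (−∑ J^μ n_μ)` over `ℝ³`
  have hleaf : ∀ t, 0 ≤ t → t ≤ s →
      (∫ y in closedBall (0 : E3) ρ, ∑ μ, J' μ (E4.ofTimeSpace (t + F y) y) *
        Kerr.graphConormal F y μ) = ∫ y : E3, W (E4.ofTimeSpace (t + F y) y) *
          (-∑ μ, J μ (E4.ofTimeSpace (t + F y) y) * Kerr.graphConormal F y μ) := by
    intro t ht0 hts
    rw [setIntegral_eq_integral_of_forall_compl_eq_zero]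
    · congr 1
      funext y
      simp only [hJ']
      rw [mul_neg, Finset.mul_sum, ← Finset.sum_neg_distrib]
      exact Finset.sum_congr rfl fun μ _ ↦ by ring
    · intro y hy
      have hW : W (E4.ofTimeSpace (t + F y) y) = 0 := by
        refine hWK _ fun hK ↦ hy ?_
        have h := (hρ _ hK
          (by simp only [E4.spatial_ofTimeSpace, E4.ofTimeSpace_apply_zero]; linarith)
          (by simp only [E4.spatial_ofTimeSpace, E4.ofTimeSpace_apply_zero]; linarith)).1
        rw [E4.spatialNorm_ofTimeSpace] at h
        exact mem_closedBall_zero_iff.mpr h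
      simp only [hJ', hW, zero_mul, neg_zero, Finset.sum_const_zero]
  rw [← hleaf s hs0 le_rfl, ← hleaf 0 le_rfl hs0]
  exact key

/-! ### The geometry of the slab points of the solid cone -/

/-- **Slab points of the solid cone are early and spatially bounded.** If `u₁(x) ≥ 0`
(`‖x⃗ − c‖ ≤ |A − x⁰|`), `F(x⃗) ≤ x⁰ ≤ s + F(x⃗)` with `|F(x⃗) − F(c)| ≤ ‖x⃗ − c‖/2` and
`s + F(c) < A`, then `‖x⃗‖ ≤ ‖c‖ + 2(A − F(c))` and `x⁰ < A`: if `x⁰ ≥ A` then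
`x⁰ ≤ s + F(c) + (x⁰ − A)/2 < (A + x⁰)/2`, absurd; so `x⁰ < A` and
`‖x⃗ − c‖ ≤ A − F(x⃗) ≤ A − F(c) + ‖x⃗ − c‖/2`. [folklore] -/
theorem spatialNorm_le_of_coneFn_nonneg_of_slab {A s : ℝ} {c : E3} {F : E3 → ℝ} {x : E4}
    (hlip : |F (E4.spatial x) - F c| ≤ 2⁻¹ * ‖E4.spatial x - c‖) (hsA : s + F c < A)
    (hcone : 0 ≤ Kerr.coneFn A c x) (h1 : F (E4.spatial x) ≤ x 0)
    (h2 : x 0 ≤ s + F (E4.spatial x)) :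
    E4.spatialNorm x ≤ ‖c‖ + 2 * (A - F c) ∧ x 0 < A := by
  have habs : ‖E4.spatial x - c‖ ≤ |A - x 0| := by
    have h : ‖E4.spatial x - c‖ ^ 2 ≤ (A - x 0) ^ 2 := by
      have : 0 ≤ (A - x 0) ^ 2 - ‖E4.spatial x - c‖ ^ 2 := hcone
      linarith
    have h' := sq_le_sq.mp h
    rwa [abs_of_nonneg (norm_nonneg _)] at h'
  have hFl := abs_le.mp hlip
  have htri : ‖E4.spatial x‖ - ‖c‖ ≤ ‖E4.spatial x - c‖ := norm_sub_norm_le _ _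
  unfold E4.spatialNorm
  rcases le_or_gt A (x 0) with hAt | htA
  · exfalso
    rw [abs_of_nonpos (by linarith)] at habs
    linarith [hFl.2]
  · rw [abs_of_pos (by linarith)] at habs
    exact ⟨by linarith [hFl.1], htA⟩

/-! ### The registered stub -/

/-- **The weighted `T`-energy inequality between tilted leaves** (crux
`stmt-FinalStateConjecture-14310`, line `Sketch`, stub `weightedTEnergy_graph_le`). For the
tails-cut zero-spin Kerr–Schild field `G₀`, the Killing current `J^T = (KerrSchild.multiplierCurrent
G₀ KerrSchild.timeField Φ)` and the weight `W = χ(u₂/ε − 1) χ(u₁)` (`u₂ = Kerr.horizonFn M 0`,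
`u₁ = Kerr.coneFn A c`), if `W J^T ∈ C¹(ℝ⁴)` and `∑_μ ∂_μ(W (J^T)^μ) ≥ 0` at the points of the slab
`{F(x⃗) ≤ x⁰ ≤ s + F(x⃗)}` with `r > 2M`, `x⁰ < A` (`F ∈ C²` of slope `≤ 1/2`, `0 ≤ s`,
`s + F(c) < A`), then `∫ W (−∑ (J^T)^μ n_μ)` over the leaf `{x⁰ = s + F}` is at most the same over
`{x⁰ = F}` (`n = Kerr.graphConormal F`). Proof: `weightedGraphFlux_integral_le` with the closed
support set `K = {ε ≤ u₂} ∩ {0 ≤ u₁}` (off `K` a factor of `W` vanishes,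
`Real.smoothTransition.zero_of_nonpos`; on `K`, `r > r₊ = 2M` by
`Kerr.rPlus_lt_radius_of_horizonFn_pos`), the slab geometry
`spatialNorm_le_of_coneFn_nonneg_of_slab` and the mean value inequality
`Convex.norm_image_sub_le_of_norm_fderiv_le`. Dafermos–Rodnianski–Shlapentokh-Rothman
arXiv:1402.7034, §2.3.2. [cite: DafermosRodnianskiShlapentokhrothman2014, §2.3.2] -/
theorem weightedTEnergy_graph_le : ∀ (M ε A : ℝ) (c : E3) (F : E3 → ℝ) (Φ : E4 → ℝ) (s : ℝ),
    0 < M → 0 < ε → ContDiff ℝ 2 F → (∀ y, ‖fderiv ℝ F y‖ ≤ 2⁻¹) → 0 ≤ s → s + F c < A →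
    (∀ μ : Fin 4, ContDiff ℝ 1 (fun y ↦
        (Real.smoothTransition (Kerr.horizonFn M 0 y / ε - 1) * Real.smoothTransition (Kerr.coneFn A c y)) *
          KerrSchild.multiplierCurrent
            (KerrSchild.inverseMetric
              (fun z ↦ Real.smoothTransition (2 - Kerr.radius 0 z / (8 * M)) * (2 * Kerr.scalarH M 0 z))
              (Kerr.nullVector 0))
            KerrSchild.timeField Φ y μ)) →
    (∀ x : E4, F (E4.spatial x) ≤ x 0 → x 0 ≤ s + F (E4.spatial x) → 2 * M < Kerr.radius 0 x → x 0 < A →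
      0 ≤ ∑ μ, fderiv ℝ (fun y ↦
        (Real.smoothTransition (Kerr.horizonFn M 0 y / ε - 1) * Real.smoothTransition (Kerr.coneFn A c y)) *
          KerrSchild.multiplierCurrent
            (KerrSchild.inverseMetric
              (fun z ↦ Real.smoothTransition (2 - Kerr.radius 0 z / (8 * M)) * (2 * Kerr.scalarH M 0 z))
              (Kerr.nullVector 0))
            KerrSchild.timeField Φ y μ) x (E4.basisVector μ)) →
    ∫ y : E3, (Real.smoothTransition (Kerr.horizonFn M 0 (E4.ofTimeSpace (s + F y) y) / ε - 1) *
          Real.smoothTransition (Kerr.coneFn A c (E4.ofTimeSpace (s + F y) y))) *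
        (-∑ μ, KerrSchild.multiplierCurrent
            (KerrSchild.inverseMetric
              (fun z ↦ Real.smoothTransition (2 - Kerr.radius 0 z / (8 * M)) * (2 * Kerr.scalarH M 0 z))
              (Kerr.nullVector 0))
            KerrSchild.timeField Φ (E4.ofTimeSpace (s + F y) y) μ * Kerr.graphConormal F y μ) ≤
      ∫ y : E3, (Real.smoothTransition (Kerr.horizonFn M 0 (E4.ofTimeSpace (0 + F y) y) / ε - 1) *
          Real.smoothTransition (Kerr.coneFn A c (E4.ofTimeSpace (0 + F y) y))) *
        (-∑ μ, KerrSchild.multiplierCurrent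
            (KerrSchild.inverseMetric
              (fun z ↦ Real.smoothTransition (2 - Kerr.radius 0 z / (8 * M)) * (2 * Kerr.scalarH M 0 z))
              (Kerr.nullVector 0))
            KerrSchild.timeField Φ (E4.ofTimeSpace (0 + F y) y) μ * Kerr.graphConormal F y μ) := by
  intro M ε A c F Φ s hM hε hF hdF hs0 hsA hJ1 hdiv
  -- the support set of the weight: closed
  set K : Set E4 := {x | ε ≤ Kerr.horizonFn M 0 x ∧ 0 ≤ Kerr.coneFn A c x} with hK
  have hKc : IsClosed K := by
    rw [hK, Set.setOf_and]
    exact (isClosed_le continuous_const (Kerr.continuous_horizonFn M 0)).inter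
      (isClosed_le continuous_const (Kerr.continuous_coneFn A c))
  -- the weight vanishes off `K`
  have hWK : ∀ x, x ∉ K →
      Real.smoothTransition (Kerr.horizonFn M 0 x / ε - 1) *
        Real.smoothTransition (Kerr.coneFn A c x) = 0 := by
    intro x hx
    by_contra hne
    refine hx ⟨(Kerr.lt_horizonFn_of_weight_ne_zero hε (left_ne_zero_of_mul hne)).le, ?_⟩
    by_contra hlt
    exact right_ne_zero_of_mul hne (Real.smoothTransition.zero_of_nonpos (not_le.mp hlt).le)
  -- the mean value inequality for the height `F`
  have hlip : ∀ y : E3, |F y - F c| ≤ 2⁻¹ * ‖y - c‖ := fun y ↦ by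
    rw [← Real.norm_eq_abs]
    exact convex_univ.norm_image_sub_le_of_norm_fderiv_le
      (fun z _ ↦ hF.differentiable (by simp) z) (fun z _ ↦ hdF z) (mem_univ c) (mem_univ y)
  -- slab points of `K`: spatially bounded, strictly exterior, early
  have hρ : ∀ x ∈ K, F (E4.spatial x) ≤ x 0 → x 0 ≤ s + F (E4.spatial x) →
      E4.spatialNorm x ≤ ‖c‖ + 2 * (A - F c) ∧ (2 * M < Kerr.radius 0 x ∧ x 0 < A) := by
    intro x hx h1 h2
    have hr : 2 * M < Kerr.radius 0 x := by
      rw [← Kerr.rPlus_zero_right hM.le]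
      exact Kerr.rPlus_lt_radius_of_horizonFn_pos (lt_of_lt_of_le hε hx.1)
    have hg := spatialNorm_le_of_coneFn_nonneg_of_slab (hlip (E4.spatial x)) hsA hx.2 h1 h2
    exact ⟨hg.1, hr, hg.2⟩
  exact weightedGraphFlux_integral_le (P := fun x ↦ 2 * M < Kerr.radius 0 x ∧ x 0 < A)
    (W := fun y ↦ Real.smoothTransition (Kerr.horizonFn M 0 y / ε - 1) *
      Real.smoothTransition (Kerr.coneFn A c y))
    (J := fun μ y ↦ KerrSchild.multiplierCurrent (KerrSchild.inverseMetric
      (fun z ↦ Real.smoothTransition (2 - Kerr.radius 0 z / (8 * M)) * (2 * Kerr.scalarH M 0 z))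
      (Kerr.nullVector 0)) KerrSchild.timeField Φ y μ)
    hKc hJ1 hWK hF hρ (fun x h1 h2 hP ↦ hdiv x h1 h2 hP.1 hP.2) hs0

end Summit.FinalStateConjecture.FinalStateConjecture.Theorems
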